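import Literature.Analysis.Complex.RiemannSphereDbar
import Literature.Analysis.FunctionSpaces.ContDiffHolderEvaluation
import HarnessLib

/-!
# Zeroth-order operators on Hölder sections of line bundles over the Riemann sphere

Topic `Literature/Analysis/Complex`. Layer B2c of the analytic core of the local-foliation theorem
for embedded `J`-spheres (Wendl 2018, Thm. 2.46 and Prop. 2.53), on the Hölder spaces
`𝓗^{k,r}_τ(F) = RiemannSphere.holderSections F τ k r` of sections of the line bundle with
clutching function `τ` over `S² = ℂ_z ∪ ℂ_w`, `w = z⁻¹`
(`Literature/Analysis/Complex/RiemannSphereHolderSections.lean`), and the cut-off chart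
representatives `cutSec₀CLM p = ρ₄ • sec₀ p`, `cutSec₁CLM p = ρ₄ • sec₁ p`
(`Literature/Analysis/Complex/RiemannSphereDbar.lean`).

* `RiemannSphere.cutSec₀CLM_eventuallyEq_sec₀`, `fderiv_cutSec₀CLM_of_norm_lt`,
  `iteratedFDeriv_cutSec₀CLM_of_norm_lt` (and the `w`-chart versions) — on the open disc
  `‖z‖ < 4` the cut-off representative IS the representative, with all its jets;
* `RiemannSphere.contDiff_eval_cutSec₀CLM`, `contDiff_eval_sec₀`, `contDiffOn_eval_sec₀` —
  **joint regularity of evaluation**: `(p, z) ↦ sec₀ p z` is jointly `C^k` on `𝓗^{k,r}_τ × ℂ`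
  (the evaluation map of `C^{k,r}_b(ℂ, F) × ℂ` is jointly `C^k`,
  `ContDiffHolderFunction.contDiff_eval`, composed with the bounded operator `cutSec₀CLM`; off the
  disc, the clutching), and `contDiff_eval_fderiv_sec₀` — `(p, z) ↦ D(sec₀ p)(z)` is jointly `C^k`
  on `𝓗^{k+1,r}_τ × ℂ`;
* `RiemannSphere.sec₀_eq_of_pieces`, `sec₁_eq_of_pieces` — the representatives read back from a
  clutched pair of pieces `(ρ • f₀, ρ • f₁)` are `f₀`, `f₁`;
* `RiemannSphere.mulSec hτ hτs hτ' hr a₀ a₁ ha₀ ha₁ hcl : 𝓗^{k,r}_τ(F) →L[ℝ] 𝓗^{k,r}_{τ'}(F')` —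
  **the zeroth-order (multiplication) operator** with smooth real-linear coefficient fields
  `a₀ a₁ : ℂ → (F →L[ℝ] F')` in the two charts, compatible with the clutchings
  (`a₁ w (τ w • x) = τ' w • a₀ w⁻¹ x`, `w ≠ 0`): its pieces are `(ρ • a₀ · sec₀ p, ρ • a₁ · sec₁ p)`
  (a compactly supported smooth operator-valued coefficient paired with a member of `C^{k,r}_b`,
  `ContDiffHolderFunction.bilinearCLM`), and in the charts it is `sec₀ (mulSec p) = a₀ · sec₀ p`,
  `sec₁ (mulSec p) = a₁ · sec₁ p` on all of `ℂ` (`sec₀_mulSec`, `sec₁_mulSec`);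
* `RiemannSphere.isCompactOperator_mulSec_comp_inclCLM`, `isCompactOperator_inclCLM_comp_mulSec`
  — composed with the compact inclusion `𝓗^{k+1,r} → 𝓗^{k,r}` it is compact (`F` finite
  dimensional, `0 < r ≤ 1`);
* `RiemannSphere.inclCLM_comp_mulSec` — level compatibility;
* `RiemannSphere.SmoothSection.mulBy`, `mulSec_toHolder` — on smooth sections it is the pointwise
  product.

Everything is proved; no named facts. The spaces are real Banach spaces; `F`, `F'` are complex
Banach spaces in universe `0` (the Leibniz estimate behind `bilinearCLM` and the joint smoothness
of evaluation are one-universe statements).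

## References

* C. Wendl, *Holomorphic Curves in Low Dimensions*, LNM 2216 (2018), §2.1.3, Thm. 2.46,
  Prop. 2.53. [Wendl2018]
* D. D. Joyce, *Riemannian Holonomy Groups and Calibrated Geometry* (2007), §1.2. [Joyce2007]
* D. Gilbarg, N. S. Trudinger, *Elliptic Partial Differential Equations of Second Order* (2001),
  §4.1, Lemma 6.36. [GilbargTrudinger2001]
-/

noncomputable section

open Set Filter Metric Function Complex
open scoped Topology NNReal ContDiff

namespace Literature.Analysis.Complex

namespace RiemannSphere

open Literature.Analysis.FunctionSpaces

/-! ### Complements on the outer cutoff `ρ₄` -/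

/-- `ρ₄ = 0` off the open disc of radius `5`. [folklore] -/
theorem rhoCut₄_eq_zero {z : ℂ} (hz : 5 ≤ ‖z‖) : rhoCut₄ z = 0 :=
  rhoCut₄Bump.zero_of_le_dist (by simpa [rhoCut₄Bump] using hz)

/-- `ρ₄ ≥ 0`. [folklore] -/
theorem rhoCut₄_nonneg (z : ℂ) : 0 ≤ rhoCut₄ z := rhoCut₄Bump.nonneg

/-- `ρ₄ ≤ 1`. [folklore] -/
theorem rhoCut₄_le_one (z : ℂ) : rhoCut₄ z ≤ 1 := rhoCut₄Bump.le_one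

/-- `ρ₄` is supported in the closed disc of radius `5`. [folklore] -/
theorem tsupport_rhoCut₄_subset : tsupport rhoCut₄ ⊆ closedBall (0 : ℂ) 5 := by
  rw [show rhoCut₄ = (rhoCut₄Bump : ℂ → ℝ) from rfl, rhoCut₄Bump.tsupport_eq]
  simp [rhoCut₄Bump]

/-- Points where `ρ₄ ≠ 0` lie in the open disc of radius `5`. [folklore] -/
theorem norm_lt_five_of_rhoCut₄_ne_zero {z : ℂ} (hz : rhoCut₄ z ≠ 0) : ‖z‖ < 5 := by
  by_contra h
  exact hz (rhoCut₄_eq_zero (not_lt.1 h))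

variable {F F' : Type} [NormedAddCommGroup F] [NormedSpace ℂ F] [NormedAddCommGroup F']
  [NormedSpace ℂ F'] {τ τ' : ℂ → ℂ} {k : ℕ} {r : ℝ≥0}

/-! ### The cut-off representatives near the discs: values and jets -/

section CutSec

variable [CompleteSpace F]

/-- Near a point of the open disc `‖z‖ < 4`, `cutSec₀CLM p` agrees with the `z`-representative.
[folklore] -/
theorem cutSec₀CLM_eventuallyEq_sec₀ (hτ : ∀ w, w ≠ 0 → τ w ≠ 0)
    (hτs : ContDiffOn ℝ ∞ τ {w | w ≠ 0}) (hr : r ≤ 1) (p : holderSections F τ k r) {z : ℂ}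
    (hz : ‖z‖ < 4) :
    ((cutSec₀CLM hτ hτs hr p : ContDiffHolderFunction ℂ F k r) : ℂ → F) =ᶠ[𝓝 z]
      sec₀ τ (p : ContDiffHolderFunction ℂ F k r × ContDiffHolderFunction ℂ F k r) := by
  filter_upwards [(isOpen_lt continuous_norm continuous_const).mem_nhds hz] with y hy
  exact cutSec₀CLM_apply_of_norm_le hτ hτs hr p hy.le

/-- Near a point of the open disc `‖w‖ < 4`, `cutSec₁CLM p` agrees with the `w`-representative.
[folklore] -/
theorem cutSec₁CLM_eventuallyEq_sec₁ (hτs : ContDiffOn ℝ ∞ τ {w | w ≠ 0}) (hr : r ≤ 1)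
    (p : holderSections F τ k r) {w : ℂ} (hw : ‖w‖ < 4) :
    ((cutSec₁CLM hτs hr p : ContDiffHolderFunction ℂ F k r) : ℂ → F) =ᶠ[𝓝 w]
      sec₁ τ (p : ContDiffHolderFunction ℂ F k r × ContDiffHolderFunction ℂ F k r) := by
  filter_upwards [(isOpen_lt continuous_norm continuous_const).mem_nhds hw] with y hy
  exact cutSec₁CLM_apply_of_norm_le hτs hr p hy.le

/-- **The derivative of the cut-off `z`-representative on the disc `‖z‖ < 4`** is that of the
`z`-representative (`fderiv` is local). [folklore] -/
theorem fderiv_cutSec₀CLM_of_norm_lt (hτ : ∀ w, w ≠ 0 → τ w ≠ 0)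
    (hτs : ContDiffOn ℝ ∞ τ {w | w ≠ 0}) (hr : r ≤ 1) (p : holderSections F τ k r) {z : ℂ}
    (hz : ‖z‖ < 4) :
    fderiv ℝ ((cutSec₀CLM hτ hτs hr p : ContDiffHolderFunction ℂ F k r) : ℂ → F) z =
      fderiv ℝ (sec₀ τ (p : ContDiffHolderFunction ℂ F k r × ContDiffHolderFunction ℂ F k r)) z :=
  (cutSec₀CLM_eventuallyEq_sec₀ hτ hτs hr p hz).fderiv_eq

/-- The derivative of the cut-off `w`-representative on the disc `‖w‖ < 4`. [folklore] -/
theorem fderiv_cutSec₁CLM_of_norm_lt (hτs : ContDiffOn ℝ ∞ τ {w | w ≠ 0}) (hr : r ≤ 1)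
    (p : holderSections F τ k r) {w : ℂ} (hw : ‖w‖ < 4) :
    fderiv ℝ ((cutSec₁CLM hτs hr p : ContDiffHolderFunction ℂ F k r) : ℂ → F) w =
      fderiv ℝ (sec₁ τ (p : ContDiffHolderFunction ℂ F k r × ContDiffHolderFunction ℂ F k r)) w :=
  (cutSec₁CLM_eventuallyEq_sec₁ hτs hr p hw).fderiv_eq

/-- **All jets of the cut-off `z`-representative on the disc `‖z‖ < 4`** are those of the
`z`-representative. [folklore] -/
theorem iteratedFDeriv_cutSec₀CLM_of_norm_lt (hτ : ∀ w, w ≠ 0 → τ w ≠ 0)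
    (hτs : ContDiffOn ℝ ∞ τ {w | w ≠ 0}) (hr : r ≤ 1) (p : holderSections F τ k r) {z : ℂ}
    (hz : ‖z‖ < 4) (n : ℕ) :
    iteratedFDeriv ℝ n ((cutSec₀CLM hτ hτs hr p : ContDiffHolderFunction ℂ F k r) : ℂ → F) z =
      iteratedFDeriv ℝ n
        (sec₀ τ (p : ContDiffHolderFunction ℂ F k r × ContDiffHolderFunction ℂ F k r)) z :=
  ((cutSec₀CLM_eventuallyEq_sec₀ hτ hτs hr p hz).iteratedFDeriv ℝ n).eq_of_nhds

/-- All jets of the cut-off `w`-representative on the disc `‖w‖ < 4`. [folklore] -/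
theorem iteratedFDeriv_cutSec₁CLM_of_norm_lt (hτs : ContDiffOn ℝ ∞ τ {w | w ≠ 0}) (hr : r ≤ 1)
    (p : holderSections F τ k r) {w : ℂ} (hw : ‖w‖ < 4) (n : ℕ) :
    iteratedFDeriv ℝ n ((cutSec₁CLM hτs hr p : ContDiffHolderFunction ℂ F k r) : ℂ → F) w =
      iteratedFDeriv ℝ n
        (sec₁ τ (p : ContDiffHolderFunction ℂ F k r × ContDiffHolderFunction ℂ F k r)) w :=
  ((cutSec₁CLM_eventuallyEq_sec₁ hτs hr p hw).iteratedFDeriv ℝ n).eq_of_nhds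

/-- The cut-off `z`-representative vanishes off the disc `‖z‖ < 5`. [folklore] -/
theorem cutSec₀CLM_apply_of_le (hτ : ∀ w, w ≠ 0 → τ w ≠ 0)
    (hτs : ContDiffOn ℝ ∞ τ {w | w ≠ 0}) (hr : r ≤ 1) (p : holderSections F τ k r) {z : ℂ}
    (hz : 5 ≤ ‖z‖) : cutSec₀CLM hτ hτs hr p z = 0 := by
  rw [cutSec₀CLM_apply, rhoCut₄_eq_zero hz, Complex.ofReal_zero, zero_smul]

/-- The cut-off `w`-representative vanishes off the disc `‖w‖ < 5`. [folklore] -/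
theorem cutSec₁CLM_apply_of_le (hτs : ContDiffOn ℝ ∞ τ {w | w ≠ 0}) (hr : r ≤ 1)
    (p : holderSections F τ k r) {w : ℂ} (hw : 5 ≤ ‖w‖) : cutSec₁CLM hτs hr p w = 0 := by
  rw [cutSec₁CLM_apply, rhoCut₄_eq_zero hw, Complex.ofReal_zero, zero_smul]

/-- The cut-off `z`-representative is supported in the closed disc of radius `5`. [folklore] -/
theorem tsupport_cutSec₀CLM_subset (hτ : ∀ w, w ≠ 0 → τ w ≠ 0)
    (hτs : ContDiffOn ℝ ∞ τ {w | w ≠ 0}) (hr : r ≤ 1) (p : holderSections F τ k r) :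
    tsupport ((cutSec₀CLM hτ hτs hr p : ContDiffHolderFunction ℂ F k r) : ℂ → F) ⊆
      closedBall (0 : ℂ) 5 := by
  refine closure_minimal (fun z hz => ?_) isClosed_closedBall
  rw [mem_closedBall, dist_zero_right]
  by_contra h
  exact hz (cutSec₀CLM_apply_of_le hτ hτs hr p (not_le.1 h).le)

/-- The cut-off `w`-representative is supported in the closed disc of radius `5`. [folklore] -/
theorem tsupport_cutSec₁CLM_subset (hτs : ContDiffOn ℝ ∞ τ {w | w ≠ 0}) (hr : r ≤ 1)
    (p : holderSections F τ k r) :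
    tsupport ((cutSec₁CLM hτs hr p : ContDiffHolderFunction ℂ F k r) : ℂ → F) ⊆
      closedBall (0 : ℂ) 5 := by
  refine closure_minimal (fun w hw => ?_) isClosed_closedBall
  rw [mem_closedBall, dist_zero_right]
  by_contra h
  exact hw (cutSec₁CLM_apply_of_le hτs hr p (not_le.1 h).le)

/-! ### Joint regularity of evaluation -/

/-- **`(p, z) ↦ cutSec₀CLM p z` is jointly `C^k` on `𝓗^{k,r}_τ × ℂ`**: the evaluation map of
`C^{k,r}_b(ℂ, F) × ℂ` is jointly `C^k` (`ContDiffHolderFunction.contDiff_eval`) and `cutSec₀CLM`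
is a bounded linear operator. [folklore] -/
theorem contDiff_eval_cutSec₀CLM (hτ : ∀ w, w ≠ 0 → τ w ≠ 0)
    (hτs : ContDiffOn ℝ ∞ τ {w | w ≠ 0}) (hr : r ≤ 1) :
    ContDiff ℝ k fun q : holderSections F τ k r × ℂ => cutSec₀CLM hτ hτs hr q.1 q.2 :=
  (ContDiffHolderFunction.contDiff_eval (E := ℂ) (r := r) k (G := F)).comp
    (((cutSec₀CLM hτ hτs hr).contDiff.comp contDiff_fst).prodMk contDiff_snd)

/-- **`(p, w) ↦ cutSec₁CLM p w` is jointly `C^k` on `𝓗^{k,r}_τ × ℂ`.** [folklore] -/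
theorem contDiff_eval_cutSec₁CLM (hτs : ContDiffOn ℝ ∞ τ {w | w ≠ 0}) (hr : r ≤ 1) :
    ContDiff ℝ k fun q : holderSections F τ k r × ℂ => cutSec₁CLM hτs hr q.1 q.2 :=
  (ContDiffHolderFunction.contDiff_eval (E := ℂ) (r := r) k (G := F)).comp
    (((cutSec₁CLM hτs hr).contDiff.comp contDiff_fst).prodMk contDiff_snd)

/-- `(p, z) ↦ g₁ (z⁻¹)`, the second piece evaluated at the inverted point, is jointly `C^k` near
every `(p, z)` with `z ≠ 0`. [folklore] -/
theorem contDiffAt_eval_snd_inv {q : holderSections F τ k r × ℂ} (hq : q.2 ≠ 0) :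
    ContDiffAt ℝ k (fun q' : holderSections F τ k r × ℂ =>
      (q'.1 : ContDiffHolderFunction ℂ F k r × ContDiffHolderFunction ℂ F k r).2 q'.2⁻¹) q := by
  have hinv : ContDiffAt ℝ k (fun q' : holderSections F τ k r × ℂ => q'.2⁻¹) q :=
    ((contDiffAt_inv ℂ hq (n := k)).restrict_scalars ℝ).comp q contDiffAt_snd
  have hL : ContDiff ℝ k fun q' : holderSections F τ k r × ℂ =>
      ((q'.1 : ContDiffHolderFunction ℂ F k r × ContDiffHolderFunction ℂ F k r).2 :
        ContDiffHolderFunction ℂ F k r) :=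
    (((ContinuousLinearMap.snd ℝ (ContDiffHolderFunction ℂ F k r)
      (ContDiffHolderFunction ℂ F k r)).comp (holderSections F τ k r).subtypeL).contDiff).comp
      contDiff_fst
  exact (ContDiffHolderFunction.contDiff_eval (E := ℂ) (r := r) k (G := F)).contDiffAt.comp q
    (hL.contDiffAt.prodMk hinv)

/-- `(p, w) ↦ g₀ (w⁻¹)`, the first piece evaluated at the inverted point, is jointly `C^k` near
every `(p, w)` with `w ≠ 0`. [folklore] -/
theorem contDiffAt_eval_fst_inv {q : holderSections F τ k r × ℂ} (hq : q.2 ≠ 0) :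
    ContDiffAt ℝ k (fun q' : holderSections F τ k r × ℂ =>
      (q'.1 : ContDiffHolderFunction ℂ F k r × ContDiffHolderFunction ℂ F k r).1 q'.2⁻¹) q := by
  have hinv : ContDiffAt ℝ k (fun q' : holderSections F τ k r × ℂ => q'.2⁻¹) q :=
    ((contDiffAt_inv ℂ hq (n := k)).restrict_scalars ℝ).comp q contDiffAt_snd
  have hL : ContDiff ℝ k fun q' : holderSections F τ k r × ℂ =>
      ((q'.1 : ContDiffHolderFunction ℂ F k r × ContDiffHolderFunction ℂ F k r).1 :
        ContDiffHolderFunction ℂ F k r) :=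
    (((ContinuousLinearMap.fst ℝ (ContDiffHolderFunction ℂ F k r)
      (ContDiffHolderFunction ℂ F k r)).comp (holderSections F τ k r).subtypeL).contDiff).comp
      contDiff_fst
  exact (ContDiffHolderFunction.contDiff_eval (E := ℂ) (r := r) k (G := F)).contDiffAt.comp q
    (hL.contDiffAt.prodMk hinv)

/-- **Joint regularity of the `z`-representative**: `(p, z) ↦ sec₀ p z` is jointly `C^k` on all of
`𝓗^{k,r}_τ × ℂ` (near the disc `‖z‖ < 4` it is `cutSec₀CLM p z`; for `‖z‖ > 1/2` it is
`(τ z⁻¹)⁻¹ • g₁ (z⁻¹)`). [folklore] -/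
theorem contDiff_eval_sec₀ (hτ : ∀ w, w ≠ 0 → τ w ≠ 0) (hτs : ContDiffOn ℝ ∞ τ {w | w ≠ 0})
    (hr : r ≤ 1) :
    ContDiff ℝ k fun q : holderSections F τ k r × ℂ =>
      sec₀ τ (q.1 : ContDiffHolderFunction ℂ F k r × ContDiffHolderFunction ℂ F k r) q.2 := by
  refine contDiff_iff_contDiffAt.2 fun q => ?_
  by_cases h4 : ‖q.2‖ < 4
  · have hev : (fun q' : holderSections F τ k r × ℂ =>
        sec₀ τ (q'.1 : ContDiffHolderFunction ℂ F k r × ContDiffHolderFunction ℂ F k r) q'.2)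
          =ᶠ[𝓝 q] fun q' => cutSec₀CLM hτ hτs hr q'.1 q'.2 := by
      filter_upwards [(isOpen_lt (continuous_norm.comp continuous_snd) continuous_const).mem_nhds
        h4] with q' hq'
      exact (cutSec₀CLM_apply_of_norm_le hτ hτs hr q'.1 (le_of_lt hq')).symm
    exact (contDiff_eval_cutSec₀CLM hτ hτs hr).contDiffAt.congr_of_eventuallyEq hev
  · have hz : 2⁻¹ < ‖q.2‖ := lt_of_lt_of_le (by norm_num) (not_lt.1 h4)
    have hz0 : q.2 ≠ 0 := ne_zero_of_half_le_norm hz.le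
    have hev : (fun q' : holderSections F τ k r × ℂ =>
        sec₀ τ (q'.1 : ContDiffHolderFunction ℂ F k r × ContDiffHolderFunction ℂ F k r) q'.2)
          =ᶠ[𝓝 q] fun q' => (τ q'.2⁻¹)⁻¹ •
            (q'.1 : ContDiffHolderFunction ℂ F k r × ContDiffHolderFunction ℂ F k r).2 q'.2⁻¹ := by
      filter_upwards [(isOpen_lt continuous_const (continuous_norm.comp continuous_snd)).mem_nhds
        hz] with q' hq'
      exact sec₀_of_half_lt q'.1.2 hq'
    refine ContDiffAt.congr_of_eventuallyEq ?_ hev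
    have hinv : ContDiffAt ℝ k (fun q' : holderSections F τ k r × ℂ => q'.2⁻¹) q :=
      ((contDiffAt_inv ℂ hz0 (n := k)).restrict_scalars ℝ).comp q contDiffAt_snd
    have hτz : ContDiffAt ℝ k τ q.2⁻¹ :=
      ((hτs q.2⁻¹ (inv_ne_zero hz0)).contDiffAt
        (isOpen_ne_zero.mem_nhds (inv_ne_zero hz0))).of_le (WithTop.coe_le_coe.mpr le_top)
    have h1 : ContDiffAt ℝ k (fun q' : holderSections F τ k r × ℂ => (τ q'.2⁻¹)⁻¹) q :=
      (hτz.comp q hinv).inv (hτ _ (inv_ne_zero hz0))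
    exact h1.smul (contDiffAt_eval_snd_inv hz0)

/-- **Joint regularity of the `w`-representative**: `(p, w) ↦ sec₁ p w` is jointly `C^k` on all
of `𝓗^{k,r}_τ × ℂ`. [folklore] -/
theorem contDiff_eval_sec₁ (hτs : ContDiffOn ℝ ∞ τ {w | w ≠ 0}) (hr : r ≤ 1) :
    ContDiff ℝ k fun q : holderSections F τ k r × ℂ =>
      sec₁ τ (q.1 : ContDiffHolderFunction ℂ F k r × ContDiffHolderFunction ℂ F k r) q.2 := by
  refine contDiff_iff_contDiffAt.2 fun q => ?_
  by_cases h4 : ‖q.2‖ < 4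
  · have hev : (fun q' : holderSections F τ k r × ℂ =>
        sec₁ τ (q'.1 : ContDiffHolderFunction ℂ F k r × ContDiffHolderFunction ℂ F k r) q'.2)
          =ᶠ[𝓝 q] fun q' => cutSec₁CLM hτs hr q'.1 q'.2 := by
      filter_upwards [(isOpen_lt (continuous_norm.comp continuous_snd) continuous_const).mem_nhds
        h4] with q' hq'
      exact (cutSec₁CLM_apply_of_norm_le hτs hr q'.1 (le_of_lt hq')).symm
    exact (contDiff_eval_cutSec₁CLM hτs hr).contDiffAt.congr_of_eventuallyEq hev
  · have hw : 2⁻¹ < ‖q.2‖ := lt_of_lt_of_le (by norm_num) (not_lt.1 h4)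
    have hw0 : q.2 ≠ 0 := ne_zero_of_half_le_norm hw.le
    have hev : (fun q' : holderSections F τ k r × ℂ =>
        sec₁ τ (q'.1 : ContDiffHolderFunction ℂ F k r × ContDiffHolderFunction ℂ F k r) q'.2)
          =ᶠ[𝓝 q] fun q' => τ q'.2 •
            (q'.1 : ContDiffHolderFunction ℂ F k r × ContDiffHolderFunction ℂ F k r).1 q'.2⁻¹ := by
      filter_upwards [(isOpen_lt continuous_const (continuous_norm.comp continuous_snd)).mem_nhds
        hw] with q' hq'
      exact sec₁_of_half_lt q'.1.2 hq'
    refine ContDiffAt.congr_of_eventuallyEq ?_ hev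
    have hτw : ContDiffAt ℝ k τ q.2 :=
      ((hτs q.2 hw0).contDiffAt (isOpen_ne_zero.mem_nhds hw0)).of_le
        (WithTop.coe_le_coe.mpr le_top)
    exact (hτw.comp q contDiffAt_snd).smul (contDiffAt_eval_fst_inv hw0)

/-- The derivative of the `z`-representative of a member of `𝓗^{k+1,r}_τ` at `z` is the partial
derivative of the joint evaluation map `(p, z) ↦ sec₀ p z` along the second factor. [folklore] -/
theorem fderiv_sec₀_eq_fderiv_eval_comp_inr (hτ : ∀ w, w ≠ 0 → τ w ≠ 0)
    (hτs : ContDiffOn ℝ ∞ τ {w | w ≠ 0}) (hr : r ≤ 1) (p : holderSections F τ (k + 1) r)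
    (z : ℂ) :
    fderiv ℝ (sec₀ τ (p : ContDiffHolderFunction ℂ F (k + 1) r ×
      ContDiffHolderFunction ℂ F (k + 1) r)) z =
      (fderiv ℝ (fun q : holderSections F τ (k + 1) r × ℂ => sec₀ τ
        (q.1 : ContDiffHolderFunction ℂ F (k + 1) r × ContDiffHolderFunction ℂ F (k + 1) r) q.2)
        (p, z)).comp (ContinuousLinearMap.inr ℝ (holderSections F τ (k + 1) r) ℂ) := by
  have hG := contDiff_eval_sec₀ (F := F) (τ := τ) (k := k + 1) (r := r) hτ hτs hr
  have hd : DifferentiableAt ℝ (fun q : holderSections F τ (k + 1) r × ℂ => sec₀ τ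
      (q.1 : ContDiffHolderFunction ℂ F (k + 1) r × ContDiffHolderFunction ℂ F (k + 1) r) q.2)
      (p, z) :=
    hG.differentiable (by exact_mod_cast Nat.succ_ne_zero k) _
  have h : HasFDerivAt (sec₀ τ (p : ContDiffHolderFunction ℂ F (k + 1) r ×
      ContDiffHolderFunction ℂ F (k + 1) r)) ((fderiv ℝ (fun q : holderSections F τ (k + 1) r × ℂ
        => sec₀ τ (q.1 : ContDiffHolderFunction ℂ F (k + 1) r ×
          ContDiffHolderFunction ℂ F (k + 1) r) q.2) (p, z)).comp
        (ContinuousLinearMap.inr ℝ (holderSections F τ (k + 1) r) ℂ)) z :=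
    hd.hasFDerivAt.comp z (hasFDerivAt_prodMk_right p z)
  exact h.fderiv

/-- The derivative of the `w`-representative of a member of `𝓗^{k+1,r}_τ` at `w` is the partial
derivative of the joint evaluation map `(p, w) ↦ sec₁ p w` along the second factor. [folklore] -/
theorem fderiv_sec₁_eq_fderiv_eval_comp_inr (hτs : ContDiffOn ℝ ∞ τ {w | w ≠ 0}) (hr : r ≤ 1)
    (p : holderSections F τ (k + 1) r) (w : ℂ) :
    fderiv ℝ (sec₁ τ (p : ContDiffHolderFunction ℂ F (k + 1) r ×
      ContDiffHolderFunction ℂ F (k + 1) r)) w =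
      (fderiv ℝ (fun q : holderSections F τ (k + 1) r × ℂ => sec₁ τ
        (q.1 : ContDiffHolderFunction ℂ F (k + 1) r × ContDiffHolderFunction ℂ F (k + 1) r) q.2)
        (p, w)).comp (ContinuousLinearMap.inr ℝ (holderSections F τ (k + 1) r) ℂ) := by
  have hG := contDiff_eval_sec₁ (F := F) (τ := τ) (k := k + 1) (r := r) hτs hr
  have hd : DifferentiableAt ℝ (fun q : holderSections F τ (k + 1) r × ℂ => sec₁ τ
      (q.1 : ContDiffHolderFunction ℂ F (k + 1) r × ContDiffHolderFunction ℂ F (k + 1) r) q.2)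
      (p, w) :=
    hG.differentiable (by exact_mod_cast Nat.succ_ne_zero k) _
  have h : HasFDerivAt (sec₁ τ (p : ContDiffHolderFunction ℂ F (k + 1) r ×
      ContDiffHolderFunction ℂ F (k + 1) r)) ((fderiv ℝ (fun q : holderSections F τ (k + 1) r × ℂ
        => sec₁ τ (q.1 : ContDiffHolderFunction ℂ F (k + 1) r ×
          ContDiffHolderFunction ℂ F (k + 1) r) q.2) (p, w)).comp
        (ContinuousLinearMap.inr ℝ (holderSections F τ (k + 1) r) ℂ)) w :=
    hd.hasFDerivAt.comp w (hasFDerivAt_prodMk_right p w)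
  exact h.fderiv

/-- **Joint regularity of the derivative of the `z`-representative**: on `𝓗^{k+1,r}_τ × ℂ` the map
`(p, z) ↦ D(sec₀ p)(z)` is jointly `C^k` (the partial derivative of a jointly `C^{k+1}` map).
[folklore] -/
theorem contDiff_eval_fderiv_sec₀ (hτ : ∀ w, w ≠ 0 → τ w ≠ 0)
    (hτs : ContDiffOn ℝ ∞ τ {w | w ≠ 0}) (hr : r ≤ 1) :
    ContDiff ℝ k fun q : holderSections F τ (k + 1) r × ℂ =>
      fderiv ℝ (sec₀ τ (q.1 : ContDiffHolderFunction ℂ F (k + 1) r ×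
        ContDiffHolderFunction ℂ F (k + 1) r)) q.2 := by
  have hG := contDiff_eval_sec₀ (F := F) (τ := τ) (k := k + 1) (r := r) hτ hτs hr
  have hD : ContDiff ℝ k (fderiv ℝ fun q : holderSections F τ (k + 1) r × ℂ => sec₀ τ
      (q.1 : ContDiffHolderFunction ℂ F (k + 1) r × ContDiffHolderFunction ℂ F (k + 1) r) q.2) :=
    hG.fderiv_right (by push_cast; exact le_rfl)
  have heq : (fun q : holderSections F τ (k + 1) r × ℂ => fderiv ℝ (sec₀ τ
      (q.1 : ContDiffHolderFunction ℂ F (k + 1) r × ContDiffHolderFunction ℂ F (k + 1) r)) q.2) =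
      fun q => (fderiv ℝ (fun q : holderSections F τ (k + 1) r × ℂ => sec₀ τ
        (q.1 : ContDiffHolderFunction ℂ F (k + 1) r × ContDiffHolderFunction ℂ F (k + 1) r) q.2)
        q).comp (ContinuousLinearMap.inr ℝ (holderSections F τ (k + 1) r) ℂ) := by
    funext q
    exact fderiv_sec₀_eq_fderiv_eval_comp_inr hτ hτs hr q.1 q.2
  rw [heq]
  exact hD.clm_comp contDiff_const

/-- **Joint regularity of the derivative of the `w`-representative** on `𝓗^{k+1,r}_τ × ℂ`.
[folklore] -/
theorem contDiff_eval_fderiv_sec₁ (hτs : ContDiffOn ℝ ∞ τ {w | w ≠ 0}) (hr : r ≤ 1) :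
    ContDiff ℝ k fun q : holderSections F τ (k + 1) r × ℂ =>
      fderiv ℝ (sec₁ τ (q.1 : ContDiffHolderFunction ℂ F (k + 1) r ×
        ContDiffHolderFunction ℂ F (k + 1) r)) q.2 := by
  have hG := contDiff_eval_sec₁ (F := F) (τ := τ) (k := k + 1) (r := r) hτs hr
  have hD : ContDiff ℝ k (fderiv ℝ fun q : holderSections F τ (k + 1) r × ℂ => sec₁ τ
      (q.1 : ContDiffHolderFunction ℂ F (k + 1) r × ContDiffHolderFunction ℂ F (k + 1) r) q.2) :=
    hG.fderiv_right (by push_cast; exact le_rfl)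
  have heq : (fun q : holderSections F τ (k + 1) r × ℂ => fderiv ℝ (sec₁ τ
      (q.1 : ContDiffHolderFunction ℂ F (k + 1) r × ContDiffHolderFunction ℂ F (k + 1) r)) q.2) =
      fun q => (fderiv ℝ (fun q : holderSections F τ (k + 1) r × ℂ => sec₁ τ
        (q.1 : ContDiffHolderFunction ℂ F (k + 1) r × ContDiffHolderFunction ℂ F (k + 1) r) q.2)
        q).comp (ContinuousLinearMap.inr ℝ (holderSections F τ (k + 1) r) ℂ) := by
    funext q
    exact fderiv_sec₁_eq_fderiv_eval_comp_inr hτs hr q.1 q.2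
  rw [heq]
  exact hD.clm_comp contDiff_const

/-- The brief form: `(p, z) ↦ sec₀ p z` is `C^k` on `𝓗^{k,r}_τ × {‖z‖ < 4}`. [folklore] -/
theorem contDiffOn_eval_sec₀ (hτ : ∀ w, w ≠ 0 → τ w ≠ 0) (hτs : ContDiffOn ℝ ∞ τ {w | w ≠ 0})
    (hr : r ≤ 1) :
    ContDiffOn ℝ k (fun q : holderSections F τ k r × ℂ =>
      sec₀ τ (q.1 : ContDiffHolderFunction ℂ F k r × ContDiffHolderFunction ℂ F k r) q.2)
      ((univ : Set (holderSections F τ k r)) ×ˢ ball (0 : ℂ) 4) :=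
  (contDiff_eval_sec₀ hτ hτs hr).contDiffOn

/-- `(p, w) ↦ sec₁ p w` is `C^k` on `𝓗^{k,r}_τ × {‖w‖ < 4}`. [folklore] -/
theorem contDiffOn_eval_sec₁ (hτs : ContDiffOn ℝ ∞ τ {w | w ≠ 0}) (hr : r ≤ 1) :
    ContDiffOn ℝ k (fun q : holderSections F τ k r × ℂ =>
      sec₁ τ (q.1 : ContDiffHolderFunction ℂ F k r × ContDiffHolderFunction ℂ F k r) q.2)
      ((univ : Set (holderSections F τ k r)) ×ˢ ball (0 : ℂ) 4) :=
  (contDiff_eval_sec₁ hτs hr).contDiffOn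

end CutSec

/-! ### Representatives read back from clutched pieces; the inclusion and representatives -/

/-- **The `z`-representative read back from clutched pieces**: if `p = (ρ • f₀, ρ • f₁)` with
`f₁ w = τ w • f₀ w⁻¹` (`τ` zero-free off `0`), then `sec₀ τ p = f₀` on all of `ℂ`. [folklore] -/
theorem sec₀_eq_of_pieces (hτ : ∀ w, w ≠ 0 → τ w ≠ 0)
    {p : ContDiffHolderFunction ℂ F k r × ContDiffHolderFunction ℂ F k r} {f₀ f₁ : ℂ → F}
    (hcl : ∀ w, w ≠ 0 → f₁ w = τ w • f₀ w⁻¹) (h0 : ∀ z, p.1 z = (rhoCut z : ℂ) • f₀ z)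
    (h1 : ∀ w, p.2 w = (rhoCut w : ℂ) • f₁ w) (z : ℂ) : sec₀ τ p z = f₀ z := by
  by_cases h2 : ‖z‖ < 2
  · rw [sec₀_of_norm_lt h2, h0, rhoCut_eq_one h2.le, Complex.ofReal_one, one_smul]
  · have hz : 2⁻¹ < ‖z‖ := lt_of_lt_of_le (by norm_num) (not_lt.1 h2)
    have hz0 : z ≠ 0 := ne_zero_of_half_le_norm hz.le
    have hp : p ∈ holderSections F τ k r := (mem_holderSections_iff hτ).2 ⟨f₀, f₁, hcl, h0, h1⟩
    rw [sec₀_of_half_lt hp hz, h1, rhoCut_eq_one (norm_inv_le_two_of_half_le hz.le),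
      hcl _ (inv_ne_zero hz0), inv_inv, Complex.ofReal_one, one_smul, smul_smul,
      inv_mul_cancel₀ (hτ _ (inv_ne_zero hz0)), one_smul]

/-- **The `w`-representative read back from clutched pieces**: `sec₁ τ p = f₁`. [folklore] -/
theorem sec₁_eq_of_pieces (hτ : ∀ w, w ≠ 0 → τ w ≠ 0)
    {p : ContDiffHolderFunction ℂ F k r × ContDiffHolderFunction ℂ F k r} {f₀ f₁ : ℂ → F}
    (hcl : ∀ w, w ≠ 0 → f₁ w = τ w • f₀ w⁻¹) (h0 : ∀ z, p.1 z = (rhoCut z : ℂ) • f₀ z)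
    (h1 : ∀ w, p.2 w = (rhoCut w : ℂ) • f₁ w) (w : ℂ) : sec₁ τ p w = f₁ w := by
  by_cases h2 : ‖w‖ < 2
  · rw [sec₁_of_norm_lt h2, h1, rhoCut_eq_one h2.le, Complex.ofReal_one, one_smul]
  · have hw : 2⁻¹ < ‖w‖ := lt_of_lt_of_le (by norm_num) (not_lt.1 h2)
    have hw0 : w ≠ 0 := ne_zero_of_half_le_norm hw.le
    have hp : p ∈ holderSections F τ k r := (mem_holderSections_iff hτ).2 ⟨f₀, f₁, hcl, h0, h1⟩
    rw [sec₁_of_half_lt hp hw, h0, rhoCut_eq_one (norm_inv_le_two_of_half_le hw.le),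
      Complex.ofReal_one, one_smul, hcl _ hw0]

section InclSec

variable [CompleteSpace F]

/-- The inclusion `𝓗^{k+1,r}_τ → 𝓗^{k,r}_τ` does not change the `z`-representative. [folklore] -/
@[simp]
theorem sec₀_inclCLM (hr : r ≤ 1) (p : holderSections F τ (k + 1) r) (z : ℂ) :
    sec₀ τ (inclCLM (F := F) hr p : ContDiffHolderFunction ℂ F k r ×
      ContDiffHolderFunction ℂ F k r) z =
      sec₀ τ (p : ContDiffHolderFunction ℂ F (k + 1) r × ContDiffHolderFunction ℂ F (k + 1) r) z :=
  rfl

/-- The inclusion `𝓗^{k+1,r}_τ → 𝓗^{k,r}_τ` does not change the `w`-representative. [folklore] -/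
@[simp]
theorem sec₁_inclCLM (hr : r ≤ 1) (p : holderSections F τ (k + 1) r) (w : ℂ) :
    sec₁ τ (inclCLM (F := F) hr p : ContDiffHolderFunction ℂ F k r ×
      ContDiffHolderFunction ℂ F k r) w =
      sec₁ τ (p : ContDiffHolderFunction ℂ F (k + 1) r × ContDiffHolderFunction ℂ F (k + 1) r) w :=
  rfl

end InclSec

/-! ### Zeroth-order (multiplication) operators between section spaces -/

section MulSec

/-- **The cut-off coefficient** `ρ • a ∈ C^{k,r}_b(ℂ, F →L[ℝ] F')` of a smooth real-linear
operator field `a : ℂ → (F →L[ℝ] F')` (`r ≤ 1`; smooth with compact support). [folklore] -/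
def mulCoeff (hr : r ≤ 1) (a : ℂ → F →L[ℝ] F') (ha : ContDiff ℝ ∞ a) :
    ContDiffHolderFunction ℂ (F →L[ℝ] F') k r :=
  ⟨fun z => rhoCut z • a z, MemContDiffHolder.of_contDiff_of_hasCompactSupport
    (contDiff_rhoCut.smul ha) hasCompactSupport_rhoCut.smul_right hr⟩

/-- Pointwise: `mulCoeff hr a ha z = ρ z • a z`. [folklore] -/
@[simp]
theorem mulCoeff_apply (hr : r ≤ 1) (a : ℂ → F →L[ℝ] F') (ha : ContDiff ℝ ∞ a) (z : ℂ) :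
    mulCoeff (k := k) hr a ha z = rhoCut z • a z := rfl

variable [CompleteSpace F]

/-- **The first piece `ρ • (a₀ · sec₀ p)` of `mulSec p`** as a bounded operator
`𝓗^{k,r}_τ →L[ℝ] C^{k,r}_b(ℂ, F')`: the evaluation pairing (`bilinearCLM` with `B = id`) of the
cut-off coefficient `ρ • a₀` with the cut-off representative `cutSec₀CLM p`. [folklore] -/
def mulPiece₀CLM (hτ : ∀ w, w ≠ 0 → τ w ≠ 0) (hτs : ContDiffOn ℝ ∞ τ {w | w ≠ 0}) (hr : r ≤ 1)
    (a₀ : ℂ → F →L[ℝ] F') (ha₀ : ContDiff ℝ ∞ a₀) :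
    holderSections F τ k r →L[ℝ] ContDiffHolderFunction ℂ F' k r :=
  (ContDiffHolderFunction.bilinearCLM hr (ContinuousLinearMap.id ℝ (F →L[ℝ] F'))
    (mulCoeff hr a₀ ha₀)).comp (cutSec₀CLM hτ hτs hr)

/-- **The second piece `ρ • (a₁ · sec₁ p)` of `mulSec p`** as a bounded operator
`𝓗^{k,r}_τ →L[ℝ] C^{k,r}_b(ℂ, F')`. [folklore] -/
def mulPiece₁CLM (hτs : ContDiffOn ℝ ∞ τ {w | w ≠ 0}) (hr : r ≤ 1)
    (a₁ : ℂ → F →L[ℝ] F') (ha₁ : ContDiff ℝ ∞ a₁) :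
    holderSections F τ k r →L[ℝ] ContDiffHolderFunction ℂ F' k r :=
  (ContDiffHolderFunction.bilinearCLM hr (ContinuousLinearMap.id ℝ (F →L[ℝ] F'))
    (mulCoeff hr a₁ ha₁)).comp (cutSec₁CLM hτs hr)

/-- **Pointwise formula for the first piece**: `ρ z • a₀ z (sec₀ p z)` (`ρ₄ = 1` on the support
of `ρ`). [folklore] -/
theorem mulPiece₀CLM_apply (hτ : ∀ w, w ≠ 0 → τ w ≠ 0) (hτs : ContDiffOn ℝ ∞ τ {w | w ≠ 0})
    (hr : r ≤ 1) (a₀ : ℂ → F →L[ℝ] F') (ha₀ : ContDiff ℝ ∞ a₀) (p : holderSections F τ k r)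
    (z : ℂ) :
    mulPiece₀CLM hτ hτs hr a₀ ha₀ p z = (rhoCut z : ℂ) • a₀ z (sec₀ τ
      (p : ContDiffHolderFunction ℂ F k r × ContDiffHolderFunction ℂ F k r) z) := by
  change (rhoCut z • a₀ z) (cutSec₀CLM hτ hτs hr p z) = _
  by_cases hρ : rhoCut z = 0
  · simp [hρ]
  · have hz3 : ‖z‖ < 3 := norm_lt_three_of_rhoCut_ne_zero hρ
    rw [cutSec₀CLM_apply_of_norm_le hτ hτs hr p (by linarith), _root_.smul_apply,
      Complex.coe_smul]

/-- **Pointwise formula for the second piece**: `ρ w • a₁ w (sec₁ p w)`. [folklore] -/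
theorem mulPiece₁CLM_apply (hτs : ContDiffOn ℝ ∞ τ {w | w ≠ 0}) (hr : r ≤ 1)
    (a₁ : ℂ → F →L[ℝ] F') (ha₁ : ContDiff ℝ ∞ a₁) (p : holderSections F τ k r) (w : ℂ) :
    mulPiece₁CLM hτs hr a₁ ha₁ p w = (rhoCut w : ℂ) • a₁ w (sec₁ τ
      (p : ContDiffHolderFunction ℂ F k r × ContDiffHolderFunction ℂ F k r) w) := by
  change (rhoCut w • a₁ w) (cutSec₁CLM hτs hr p w) = _
  by_cases hρ : rhoCut w = 0
  · simp [hρ]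
  · have hw3 : ‖w‖ < 3 := norm_lt_three_of_rhoCut_ne_zero hρ
    rw [cutSec₁CLM_apply_of_norm_le hτs hr p (by linarith), _root_.smul_apply,
      Complex.coe_smul]

/-- **The pieces `(ρ • a₀ · sec₀ p, ρ • a₁ · sec₁ p)` satisfy the piece relations of the bundle
`τ'`** when the coefficients are compatible with the clutchings
(`a₁ w (τ w • x) = τ' w • a₀ w⁻¹ x`): they are the pieces of the clutched pair
`(a₀ · sec₀ p, a₁ · sec₁ p)`. [folklore] -/
theorem mulPiece_mem (hτ : ∀ w, w ≠ 0 → τ w ≠ 0) (hτs : ContDiffOn ℝ ∞ τ {w | w ≠ 0})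
    (hτ' : ∀ w, w ≠ 0 → τ' w ≠ 0) (hr : r ≤ 1) (a₀ a₁ : ℂ → F →L[ℝ] F')
    (ha₀ : ContDiff ℝ ∞ a₀) (ha₁ : ContDiff ℝ ∞ a₁)
    (hcl : ∀ w : ℂ, w ≠ 0 → ∀ x : F, a₁ w (τ w • x) = τ' w • a₀ w⁻¹ x)
    (p : holderSections F τ k r) :
    (mulPiece₀CLM hτ hτs hr a₀ ha₀ p, mulPiece₁CLM hτs hr a₁ ha₁ p) ∈
      holderSections F' τ' k r :=
  (mem_holderSections_iff hτ').2
    ⟨fun z => a₀ z (sec₀ τ (p : ContDiffHolderFunction ℂ F k r ×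
        ContDiffHolderFunction ℂ F k r) z),
      fun w => a₁ w (sec₁ τ (p : ContDiffHolderFunction ℂ F k r ×
        ContDiffHolderFunction ℂ F k r) w),
      fun w hw => by simp only [sec₁_eq_smul_sec₀ p.2 hτ hw, hcl w hw],
      fun z => mulPiece₀CLM_apply hτ hτs hr a₀ ha₀ p z,
      fun w => mulPiece₁CLM_apply hτs hr a₁ ha₁ p w⟩

/-- **The zeroth-order (multiplication) operator `𝓗^{k,r}_τ(F) →L[ℝ] 𝓗^{k,r}_{τ'}(F')`** with
smooth real-linear coefficient fields `a₀`, `a₁ : ℂ → (F →L[ℝ] F')` in the two charts, compatible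
with the clutchings (`a₁ w (τ w • x) = τ' w • a₀ w⁻¹ x` for `w ≠ 0`, so that
`f₁ w = τ w • f₀ w⁻¹ ⇒ a₁ w (f₁ w) = τ' w • (a₀ · f₀) (w⁻¹)`): in the charts it is
`sec₀ (mulSec p) = a₀ · sec₀ p`, `sec₁ (mulSec p) = a₁ · sec₁ p` (`sec₀_mulSec`, `sec₁_mulSec`),
its pieces being `(ρ • a₀ · sec₀ p, ρ • a₁ · sec₁ p)`. [cite: Wendl2018, §2.1.3] -/
def mulSec (hτ : ∀ w, w ≠ 0 → τ w ≠ 0) (hτs : ContDiffOn ℝ ∞ τ {w | w ≠ 0})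
    (hτ' : ∀ w, w ≠ 0 → τ' w ≠ 0) (hr : r ≤ 1) (a₀ a₁ : ℂ → F →L[ℝ] F')
    (ha₀ : ContDiff ℝ ∞ a₀) (ha₁ : ContDiff ℝ ∞ a₁)
    (hcl : ∀ w : ℂ, w ≠ 0 → ∀ x : F, a₁ w (τ w • x) = τ' w • a₀ w⁻¹ x) :
    holderSections F τ k r →L[ℝ] holderSections F' τ' k r :=
  ((mulPiece₀CLM hτ hτs hr a₀ ha₀).prod (mulPiece₁CLM hτs hr a₁ ha₁)).codRestrict
    (holderSections F' τ' k r) (mulPiece_mem hτ hτs hτ' hr a₀ a₁ ha₀ ha₁ hcl)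

section MulSecApply

variable {hτ : ∀ w, w ≠ 0 → τ w ≠ 0} {hτs : ContDiffOn ℝ ∞ τ {w | w ≠ 0}}
  {hτ' : ∀ w, w ≠ 0 → τ' w ≠ 0} {hr : r ≤ 1} {a₀ a₁ : ℂ → F →L[ℝ] F'}
  {ha₀ : ContDiff ℝ ∞ a₀} {ha₁ : ContDiff ℝ ∞ a₁}
  {hcl : ∀ w : ℂ, w ≠ 0 → ∀ x : F, a₁ w (τ w • x) = τ' w • a₀ w⁻¹ x}

/-- The pair of pieces of `mulSec p` is `(mulPiece₀CLM p, mulPiece₁CLM p)`. [folklore] -/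
theorem mulSec_coe (p : holderSections F τ k r) :
    ((mulSec hτ hτs hτ' hr a₀ a₁ ha₀ ha₁ hcl p : holderSections F' τ' k r) :
      ContDiffHolderFunction ℂ F' k r × ContDiffHolderFunction ℂ F' k r) =
      (mulPiece₀CLM hτ hτs hr a₀ ha₀ p, mulPiece₁CLM hτs hr a₁ ha₁ p) := rfl

/-- **The first piece of `mulSec p` is `ρ • a₀ · sec₀ p`.** [folklore] -/
@[simp]
theorem mulSec_fst_apply (p : holderSections F τ k r) (z : ℂ) :
    ((mulSec hτ hτs hτ' hr a₀ a₁ ha₀ ha₁ hcl p : holderSections F' τ' k r) :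
      ContDiffHolderFunction ℂ F' k r × ContDiffHolderFunction ℂ F' k r).1 z =
      (rhoCut z : ℂ) • a₀ z (sec₀ τ
        (p : ContDiffHolderFunction ℂ F k r × ContDiffHolderFunction ℂ F k r) z) :=
  mulPiece₀CLM_apply hτ hτs hr a₀ ha₀ p z

/-- **The second piece of `mulSec p` is `ρ • a₁ · sec₁ p`.** [folklore] -/
@[simp]
theorem mulSec_snd_apply (p : holderSections F τ k r) (w : ℂ) :
    ((mulSec hτ hτs hτ' hr a₀ a₁ ha₀ ha₁ hcl p : holderSections F' τ' k r) :
      ContDiffHolderFunction ℂ F' k r × ContDiffHolderFunction ℂ F' k r).2 w =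
      (rhoCut w : ℂ) • a₁ w (sec₁ τ
        (p : ContDiffHolderFunction ℂ F k r × ContDiffHolderFunction ℂ F k r) w) :=
  mulPiece₁CLM_apply hτs hr a₁ ha₁ p w

/-- **Chart formula, `z`-chart**: the `z`-representative of `mulSec p` is `a₀ · sec₀ p`, on all
of `ℂ`. [cite: Wendl2018, §2.1.3] -/
theorem sec₀_mulSec (p : holderSections F τ k r) (z : ℂ) :
    sec₀ τ' ((mulSec hτ hτs hτ' hr a₀ a₁ ha₀ ha₁ hcl p : holderSections F' τ' k r) :
      ContDiffHolderFunction ℂ F' k r × ContDiffHolderFunction ℂ F' k r) z =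
      a₀ z (sec₀ τ (p : ContDiffHolderFunction ℂ F k r × ContDiffHolderFunction ℂ F k r) z) :=
  sec₀_eq_of_pieces hτ' (f₀ := fun z => a₀ z (sec₀ τ (p : ContDiffHolderFunction ℂ F k r ×
      ContDiffHolderFunction ℂ F k r) z)) (f₁ := fun w => a₁ w (sec₁ τ
      (p : ContDiffHolderFunction ℂ F k r × ContDiffHolderFunction ℂ F k r) w))
    (fun w hw => by simp only [sec₁_eq_smul_sec₀ p.2 hτ hw, hcl w hw])
    (mulSec_fst_apply p) (mulSec_snd_apply p) z

/-- **Chart formula, `w`-chart**: the `w`-representative of `mulSec p` is `a₁ · sec₁ p`, on all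
of `ℂ`. [cite: Wendl2018, §2.1.3] -/
theorem sec₁_mulSec (p : holderSections F τ k r) (w : ℂ) :
    sec₁ τ' ((mulSec hτ hτs hτ' hr a₀ a₁ ha₀ ha₁ hcl p : holderSections F' τ' k r) :
      ContDiffHolderFunction ℂ F' k r × ContDiffHolderFunction ℂ F' k r) w =
      a₁ w (sec₁ τ (p : ContDiffHolderFunction ℂ F k r × ContDiffHolderFunction ℂ F k r) w) :=
  sec₁_eq_of_pieces hτ' (f₀ := fun z => a₀ z (sec₀ τ (p : ContDiffHolderFunction ℂ F k r ×
      ContDiffHolderFunction ℂ F k r) z)) (f₁ := fun w => a₁ w (sec₁ τ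
      (p : ContDiffHolderFunction ℂ F k r × ContDiffHolderFunction ℂ F k r) w))
    (fun w hw => by simp only [sec₁_eq_smul_sec₀ p.2 hτ hw, hcl w hw])
    (mulSec_fst_apply p) (mulSec_snd_apply p) w

/-- `mulSec p` read through the evaluation functional of the `z`-chart: for `‖z₀‖ < 2`,
`eval₀CLM z₀ (mulSec p) = a₀ z₀ (sec₀ p z₀)`. [folklore] -/
theorem eval₀CLM_mulSec {z₀ : ℂ} (hz₀ : ‖z₀‖ < 2) (p : holderSections F τ k r) :
    eval₀CLM (F := F') τ' k r z₀ (mulSec hτ hτs hτ' hr a₀ a₁ ha₀ ha₁ hcl p) =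
      a₀ z₀ (sec₀ τ (p : ContDiffHolderFunction ℂ F k r × ContDiffHolderFunction ℂ F k r) z₀) := by
  rw [eval₀CLM_eq_sec₀ hz₀, sec₀_mulSec]

/-- `mulSec p` read through the evaluation functional of the `w`-chart: for `‖w₀‖ < 2`,
`eval₁CLM w₀ (mulSec p) = a₁ w₀ (sec₁ p w₀)`. [folklore] -/
theorem eval₁CLM_mulSec {w₀ : ℂ} (hw₀ : ‖w₀‖ < 2) (p : holderSections F τ k r) :
    eval₁CLM (F := F') τ' k r w₀ (mulSec hτ hτs hτ' hr a₀ a₁ ha₀ ha₁ hcl p) =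
      a₁ w₀ (sec₁ τ (p : ContDiffHolderFunction ℂ F k r × ContDiffHolderFunction ℂ F k r) w₀) := by
  rw [eval₁CLM_apply, mulSec_snd_apply, rhoCut_eq_one (by linarith), Complex.ofReal_one, one_smul,
    sec₁_of_norm_lt hw₀]

/-- **The cut-off representative of `mulSec p`**: `cutSec₀CLM (mulSec p) z = ρ₄ z • a₀ z (sec₀ p z)`.
[folklore] -/
theorem cutSec₀CLM_mulSec [CompleteSpace F'] (hτ's : ContDiffOn ℝ ∞ τ' {w | w ≠ 0}) (p : holderSections F τ k r)
    (z : ℂ) :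
    cutSec₀CLM hτ' hτ's hr (mulSec hτ hτs hτ' hr a₀ a₁ ha₀ ha₁ hcl p) z =
      (rhoCut₄ z : ℂ) • a₀ z (sec₀ τ
        (p : ContDiffHolderFunction ℂ F k r × ContDiffHolderFunction ℂ F k r) z) := by
  rw [cutSec₀CLM_apply, sec₀_mulSec]

/-- The cut-off `w`-representative of `mulSec p`: `cutSec₁CLM (mulSec p) w = ρ₄ w • a₁ w (sec₁ p w)`.
[folklore] -/
theorem cutSec₁CLM_mulSec [CompleteSpace F'] (hτ's : ContDiffOn ℝ ∞ τ' {w | w ≠ 0}) (p : holderSections F τ k r)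
    (w : ℂ) :
    cutSec₁CLM hτ's hr (mulSec hτ hτs hτ' hr a₀ a₁ ha₀ ha₁ hcl p) w =
      (rhoCut₄ w : ℂ) • a₁ w (sec₁ τ
        (p : ContDiffHolderFunction ℂ F k r × ContDiffHolderFunction ℂ F k r) w) := by
  rw [cutSec₁CLM_apply, sec₁_mulSec]

end MulSecApply

/-! ### Level compatibility -/

/-- **Level compatibility**, pointwise: `inclCLM (mulSec p) = mulSec (inclCLM p)` for
`p ∈ 𝓗^{k+1,r}_τ` (both have the pieces `(ρ • a₀ · sec₀ p, ρ • a₁ · sec₁ p)`). [folklore] -/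
theorem inclCLM_mulSec [CompleteSpace F'] (hτ : ∀ w, w ≠ 0 → τ w ≠ 0) (hτs : ContDiffOn ℝ ∞ τ {w | w ≠ 0})
    (hτ' : ∀ w, w ≠ 0 → τ' w ≠ 0) (hr : r ≤ 1) (a₀ a₁ : ℂ → F →L[ℝ] F')
    (ha₀ : ContDiff ℝ ∞ a₀) (ha₁ : ContDiff ℝ ∞ a₁)
    (hcl : ∀ w : ℂ, w ≠ 0 → ∀ x : F, a₁ w (τ w • x) = τ' w • a₀ w⁻¹ x)
    (p : holderSections F τ (k + 1) r) :
    inclCLM hr (mulSec hτ hτs hτ' hr a₀ a₁ ha₀ ha₁ hcl p) =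
      mulSec hτ hτs hτ' hr a₀ a₁ ha₀ ha₁ hcl (inclCLM hr p) := by
  apply Subtype.ext
  apply Prod.ext
  · exact ContDiffHolderFunction.ext fun z => by
      rw [inclCLM_fst_apply, mulSec_fst_apply, mulSec_fst_apply, sec₀_inclCLM]
  · exact ContDiffHolderFunction.ext fun w => by
      rw [inclCLM_snd_apply, mulSec_snd_apply, mulSec_snd_apply, sec₁_inclCLM]

/-- **Level compatibility**: `inclCLM ∘L mulSec (level k+1) = mulSec (level k) ∘L inclCLM`.
[folklore] -/
theorem inclCLM_comp_mulSec [CompleteSpace F'] (hτ : ∀ w, w ≠ 0 → τ w ≠ 0) (hτs : ContDiffOn ℝ ∞ τ {w | w ≠ 0})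
    (hτ' : ∀ w, w ≠ 0 → τ' w ≠ 0) (hr : r ≤ 1) (a₀ a₁ : ℂ → F →L[ℝ] F')
    (ha₀ : ContDiff ℝ ∞ a₀) (ha₁ : ContDiff ℝ ∞ a₁)
    (hcl : ∀ w : ℂ, w ≠ 0 → ∀ x : F, a₁ w (τ w • x) = τ' w • a₀ w⁻¹ x) :
    (inclCLM hr).comp (mulSec hτ hτs hτ' hr a₀ a₁ ha₀ ha₁ hcl (k := k + 1)) =
      (mulSec hτ hτs hτ' hr a₀ a₁ ha₀ ha₁ hcl (k := k)).comp (inclCLM hr) :=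
  ContinuousLinearMap.ext fun p => inclCLM_mulSec hτ hτs hτ' hr a₀ a₁ ha₀ ha₁ hcl p

/-! ### Compactness with the inclusion -/

/-- **`mulSec ∘L incl : 𝓗^{k+1,r}_τ(F) → 𝓗^{k,r}_{τ'}(F')` is compact** (`F` finite dimensional,
`0 < r ≤ 1`): the inclusion is compact (`isCompactOperator_inclCLM`) and `mulSec` is bounded.
[cite: GilbargTrudinger2001, Lemma 6.36] -/
theorem isCompactOperator_mulSec_comp_inclCLM [FiniteDimensional ℂ F]
    (hτ : ∀ w, w ≠ 0 → τ w ≠ 0) (hτs : ContDiffOn ℝ ∞ τ {w | w ≠ 0})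
    (hτ' : ∀ w, w ≠ 0 → τ' w ≠ 0) (hr0 : 0 < r) (hr : r ≤ 1) (a₀ a₁ : ℂ → F →L[ℝ] F')
    (ha₀ : ContDiff ℝ ∞ a₀) (ha₁ : ContDiff ℝ ∞ a₁)
    (hcl : ∀ w : ℂ, w ≠ 0 → ∀ x : F, a₁ w (τ w • x) = τ' w • a₀ w⁻¹ x) :
    IsCompactOperator ((mulSec hτ hτs hτ' hr a₀ a₁ ha₀ ha₁ hcl (k := k)).comp
      (inclCLM (F := F) (τ := τ) (k := k) hr)) := by
  have h := (isCompactOperator_inclCLM (F := F) (τ := τ) (k := k) hr0 hr).clm_comp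
    (mulSec hτ hτs hτ' hr a₀ a₁ ha₀ ha₁ hcl (k := k))
  rwa [← ContinuousLinearMap.coe_comp] at h

/-- **`incl ∘L mulSec : 𝓗^{k+1,r}_τ(F) → 𝓗^{k,r}_{τ'}(F')` is compact** (`F'` finite dimensional,
`0 < r ≤ 1`). [cite: GilbargTrudinger2001, Lemma 6.36] -/
theorem isCompactOperator_inclCLM_comp_mulSec [CompleteSpace F'] [FiniteDimensional ℂ F']
    (hτ : ∀ w, w ≠ 0 → τ w ≠ 0) (hτs : ContDiffOn ℝ ∞ τ {w | w ≠ 0})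
    (hτ' : ∀ w, w ≠ 0 → τ' w ≠ 0) (hr0 : 0 < r) (hr : r ≤ 1) (a₀ a₁ : ℂ → F →L[ℝ] F')
    (ha₀ : ContDiff ℝ ∞ a₀) (ha₁ : ContDiff ℝ ∞ a₁)
    (hcl : ∀ w : ℂ, w ≠ 0 → ∀ x : F, a₁ w (τ w • x) = τ' w • a₀ w⁻¹ x) :
    IsCompactOperator ((inclCLM (F := F') (τ := τ') (k := k) hr).comp
      (mulSec hτ hτs hτ' hr a₀ a₁ ha₀ ha₁ hcl (k := k + 1))) := by
  have h := (isCompactOperator_inclCLM (F := F') (τ := τ') (k := k) hr0 hr).comp_clm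
    (mulSec hτ hτs hτ' hr a₀ a₁ ha₀ ha₁ hcl (k := k + 1))
  rwa [← ContinuousLinearMap.coe_comp] at h

/-- The same compact operator, written at level `k` through `inclCLM` on the source side.
[folklore] -/
theorem isCompactOperator_mulSec_comp_inclCLM' [CompleteSpace F'] [FiniteDimensional ℂ F']
    (hτ : ∀ w, w ≠ 0 → τ w ≠ 0) (hτs : ContDiffOn ℝ ∞ τ {w | w ≠ 0})
    (hτ' : ∀ w, w ≠ 0 → τ' w ≠ 0) (hr0 : 0 < r) (hr : r ≤ 1) (a₀ a₁ : ℂ → F →L[ℝ] F')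
    (ha₀ : ContDiff ℝ ∞ a₀) (ha₁ : ContDiff ℝ ∞ a₁)
    (hcl : ∀ w : ℂ, w ≠ 0 → ∀ x : F, a₁ w (τ w • x) = τ' w • a₀ w⁻¹ x) :
    IsCompactOperator ((mulSec hτ hτs hτ' hr a₀ a₁ ha₀ ha₁ hcl (k := k)).comp
      (inclCLM (F := F) (τ := τ) (k := k) hr)) := by
  rw [← inclCLM_comp_mulSec]
  exact isCompactOperator_inclCLM_comp_mulSec hτ hτs hτ' hr0 hr a₀ a₁ ha₀ ha₁ hcl

end MulSec

/-! ### Zeroth-order operators on smooth sections -/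

namespace SmoothSection

variable (s : SmoothSection F τ)

/-- **A smooth section multiplied by compatible smooth coefficient fields**: the pair
`(a₀ · f₀, a₁ · f₁)`, a smooth section of the bundle `τ'`. [folklore] -/
def mulBy (a₀ a₁ : ℂ → F →L[ℝ] F') (ha₀ : ContDiff ℝ ∞ a₀) (ha₁ : ContDiff ℝ ∞ a₁)
    (hcl : ∀ w : ℂ, w ≠ 0 → ∀ x : F, a₁ w (τ w • x) = τ' w • a₀ w⁻¹ x) :
    SmoothSection F' τ' where
  f₀ z := a₀ z (s.f₀ z)
  f₁ w := a₁ w (s.f₁ w)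
  smooth₀ := ha₀.clm_apply s.smooth₀
  smooth₁ := ha₁.clm_apply s.smooth₁
  clutch w hw := by
    show a₁ w (s.f₁ w) = τ' w • a₀ w⁻¹ (s.f₀ w⁻¹)
    rw [s.clutch w hw, hcl w hw]

/-- The `z`-representative of `s.mulBy a₀ a₁` is `a₀ · f₀`. [folklore] -/
@[simp]
theorem mulBy_f₀ (a₀ a₁ : ℂ → F →L[ℝ] F') (ha₀ : ContDiff ℝ ∞ a₀) (ha₁ : ContDiff ℝ ∞ a₁)
    (hcl : ∀ w : ℂ, w ≠ 0 → ∀ x : F, a₁ w (τ w • x) = τ' w • a₀ w⁻¹ x) (z : ℂ) :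
    (s.mulBy a₀ a₁ ha₀ ha₁ hcl).f₀ z = a₀ z (s.f₀ z) := rfl

/-- The `w`-representative of `s.mulBy a₀ a₁` is `a₁ · f₁`. [folklore] -/
@[simp]
theorem mulBy_f₁ (a₀ a₁ : ℂ → F →L[ℝ] F') (ha₀ : ContDiff ℝ ∞ a₀) (ha₁ : ContDiff ℝ ∞ a₁)
    (hcl : ∀ w : ℂ, w ≠ 0 → ∀ x : F, a₁ w (τ w • x) = τ' w • a₀ w⁻¹ x) (w : ℂ) :
    (s.mulBy a₀ a₁ ha₀ ha₁ hcl).f₁ w = a₁ w (s.f₁ w) := rfl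

end SmoothSection

/-- **`mulSec` of a smooth section, computed in `𝓗`**: `mulSec (s.toHolder) = (s.mulBy …).toHolder`.
[folklore] -/
theorem mulSec_toHolder [CompleteSpace F] (hτ : ∀ w, w ≠ 0 → τ w ≠ 0)
    (hτs : ContDiffOn ℝ ∞ τ {w | w ≠ 0}) (hτ' : ∀ w, w ≠ 0 → τ' w ≠ 0) (hr : r ≤ 1)
    (a₀ a₁ : ℂ → F →L[ℝ] F') (ha₀ : ContDiff ℝ ∞ a₀) (ha₁ : ContDiff ℝ ∞ a₁)
    (hcl : ∀ w : ℂ, w ≠ 0 → ∀ x : F, a₁ w (τ w • x) = τ' w • a₀ w⁻¹ x)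
    (s : SmoothSection F τ) :
    mulSec hτ hτs hτ' hr a₀ a₁ ha₀ ha₁ hcl (s.toHolder (k := k) hτ hr) =
      (s.mulBy a₀ a₁ ha₀ ha₁ hcl).toHolder hτ' hr := by
  apply Subtype.ext
  apply Prod.ext
  · exact ContDiffHolderFunction.ext fun z => by
      rw [mulSec_fst_apply, SmoothSection.toHolder_fst_apply, s.sec₀_toHolder hτ hr,
        SmoothSection.mulBy_f₀]
  · exact ContDiffHolderFunction.ext fun w => by
      rw [mulSec_snd_apply, SmoothSection.toHolder_snd_apply, s.sec₁_toHolder hτ hr,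
        SmoothSection.mulBy_f₁]

end RiemannSphere

end Literature.Analysis.Complex

end
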